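import Mathlib
import Summits.KontsevichZagierPeriods.Zeta5Search.WellPoisedFaceEnvelope
import HarnessLib.Audit
import HarnessLib

/-!
# (8.9) on the numerator-free face for general `q`: with `k = h_q` only the ALIVE bricks below `h_q` save
# — cell `pub-zeta5`, class `odd` (gen 5), target T4 (integer side of the `q ≤ 9` face no-go)

HONEST FRAMING: systematic search; no irrationality claim unless certified.  Exact integer arithmetic about a
printed construction; no rate, no limit, no irrationality statement is made in this file.

Provenance: family-designer seat `pub-zeta5-fam-odd-g5` (planner role; staged under
`run/shared/lean/pub/pub-zeta5/lean/fam-odd/`, result of record `families/odd/FAMILY.md` §5.11) for VERBATIM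
filing by the lane.  Not literature.  Companion (independent) real-side file: `WellPoisedFaceZeta57` (the envelope
`C₀ + (2 − log 2 − M log(4/3))η₀ ≤ δ − φ⁺` and the Proposition-5 no-go for `q ≤ 9`).  Imports the `q = 7` file
`WellPoisedFaceEnvelope` (class `vwp`, gen 6) for `pairTerm`, `brickTerm`, `nuKP`, `nuP`, `Phi`, `mLast` and their lemmas.

## Source (PRINTED)
W. Zudilin, *Arithmetic of linear forms involving odd zeta values*, J. Théor. Nombres Bordeaux 16 (2004)
251–291 = arXiv:math/0206176, §8 [cite: Zudilin2004, §8: (8.7)–(8.9), Lemma 19].  For `r = 3` and `q ≥ 7`,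
`Φ(h) = ∏_{√h₀ < p ≤ m_{q−3}} p^{ν_p}`, `ν_p = min_{h₄ ≤ k ≤ h₀−h₄} ν_{k,p}`, and `ν_{k,p}` = three pair summands
(`j ≤ 3`) + `q − 3` brick summands `[(h₀−2h_j)/p] − [(k−h_j)/p] − [(h₀−h_j−k)/p]` (`j ≥ 4`), `[·]` = floor.

## Dictionary
* `nuKPq h₀ h₁ h₂ h₃ h k p` = `ν_{k,p}` of (8.9) VERBATIM for `r = 3` and ANY number `B` of pole bricks
  (`q = B + 3`), the tails `h₄, …, h_q` given as `h : Fin B → ℤ`; `nuKPq_four` : for `B = 4` it IS the `q = 7`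
  file's `nuKP`.  `nuPq … kLo p` = `ν_p` (minimum over `kLo ≤ k ≤ h₀ − kLo`, `kLo = h₄`); `PhiQ … kLo m` = `Φ`
  with the prime range `√h₀ < p ≤ m`, `m = m_{q−3}` (`= mLast h₀ h₁ h₃ h₄ h_q` of the `q = 7` file); `nuPq_four`, `PhiQ_four`.
* `alive h₀ h_j k p = 1` if `h_j < k` and `p ≤ h₀ − 2h_j`, else `0`: brick `j` lies strictly below `k` and its pole
  length `h₀ − 2h_j` reaches `p`.
## Results (all sorry-free, exact over `ℤ` / `ℕ`)
* `brickTerm_eq_zero_of_lt` : a brick summand VANISHES when `h_j ≤ k ≤ h₀ − h_j` and `h₀ − 2h_j < p` (the three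
  brackets are `[a/p], [b/p], [(a+b)/p]` with `0 ≤ a, b` and `a + b < p`).  This is the new input: the `q = 7` file
  takes `k = h₄`, for which the other bricks' summands are differences `[(a+b+c)/p]`-type carries that stay `1` at
  DEAD primes, whence only `ν_p ≤ B − 1`; at `k = max_j h_j` every summand is an honest carry of its own brick.
* `brickTerm_le_alive`, `nuKPq_face_le_alive` : on the face (`h₁ = h₂ = h₃ = 1`), for any `k` with `h_j ≤ k` for
  all `j` and `2k ≤ h₀` (the text's choice: `k = h_q`, the largest tail): `ν_{k,p} ≤ Σ_j alive h₀ h_j k p` =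
  `#{j : h_j < k, p ≤ h₀ − 2h_j}`;  `nuPq_face_le_alive` : the same for `ν_p` once `kLo ≤ k ≤ h₀ − kLo`.
* `PhiQ_face_le` : `Φ ≤ ∏_{j : h_j < k} (h₀ − 2h_j)#` (primorials of the pole lengths of the bricks below `k`):
  along (8.13) and by `θ(x) ∼ x` this is `φ ≤ φ⁺ = Σ_{j<q} (η₀ − 2η_j)` (PNT bookkeeping on paper, as in the
  `q = 7` file), the `phiPlus` of `WellPoisedFaceZeta57`.  `nuKPq_nonneg`.
* Kernel instances at the `q = 9` face MODEL maximiser, `n = 1`: `h = (95; 1,1,1, 23,26,29,32,35,38)`: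
  `ν_{23,53} = 5 = B − 1` (the `q = 7` file's `k = h₄` at a dead prime) but `ν_{38,53} = 0`, `ν_{38,37} = 3`.
## What is NOT proved here
The PNT step `φ ≤ φ⁺`; anything about `C₀`; the parity bookkeeping of Lemma 19 for even `q` (class `odd`, FAMILY.md §1).
-/

noncomputable section

namespace Summit.KontsevichZagierPeriods.Zeta5Search

namespace WellPoisedFace

open Finset

/-! ### 1. (8.9) for `r = 3` and any number of bricks -/

/-- `ν_{k,p}` of [Zudilin2004, (8.9)] for `r = 3` and `q = B + 3`: heads `h₁, h₂, h₃` (pair summands) and tails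
`h : Fin B → ℤ`, `h j = h_{4+j}` (brick summands). -/
def nuKPq (h0 h1 h2 h3 : ℤ) {B : ℕ} (h : Fin B → ℤ) (k p : ℤ) : ℤ :=
  pairTerm h0 h1 k p + pairTerm h0 h2 k p + pairTerm h0 h3 k p + ∑ j, brickTerm h0 (h j) k p

/-- `ν_p = min_{kLo ≤ k ≤ h₀ − kLo} ν_{k,p}` (`kLo = h_{r+1} = h₄`); the value `0` for an empty range is never used. -/
def nuPq (h0 h1 h2 h3 : ℤ) {B : ℕ} (h : Fin B → ℤ) (kLo p : ℤ) : ℤ :=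
  if hk : kLo ≤ h0 - kLo then
    (Finset.Icc kLo (h0 - kLo)).inf' (Finset.nonempty_Icc.2 hk) fun k => nuKPq h0 h1 h2 h3 h k p
  else 0

/-- `Φ(h) = ∏_{√h₀ < p ≤ m} p^{ν_p}` with the upper end `m = m_{q−r}` supplied (`mLast h₀ h₁ h₃ h₄ h_q`). -/
def PhiQ (h0 h1 h2 h3 : ℤ) {B : ℕ} (h : Fin B → ℤ) (kLo m : ℤ) : ℕ :=
  ∏ p ∈ (Finset.Ioc (Nat.sqrt h0.toNat) m.toNat).filter Nat.Prime, p ^ (nuPq h0 h1 h2 h3 h kLo p).toNat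

/-- DICTIONARY CHECK: for `B = 4` bricks `nuKPq` is the `q = 7` file's `nuKP`. -/
theorem nuKPq_four (h0 h1 h2 h3 h4 h5 h6 h7 k p : ℤ) :
    nuKPq h0 h1 h2 h3 ![h4, h5, h6, h7] k p = nuKP h0 h1 h2 h3 h4 h5 h6 h7 k p := by
  simp only [nuKPq, nuKP, Fin.sum_univ_four, Matrix.cons_val_zero, Matrix.cons_val_one,
    Matrix.cons_val_two, Matrix.cons_val_three, Matrix.head_cons, Matrix.tail_cons]

/-- … and `nuPq` (with `kLo = h₄`) is its `nuP` … -/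
theorem nuPq_four (h0 h1 h2 h3 h4 h5 h6 h7 p : ℤ) :
    nuPq h0 h1 h2 h3 ![h4, h5, h6, h7] h4 p = nuP h0 h1 h2 h3 h4 h5 h6 h7 p := by
  unfold nuPq nuP
  simp only [nuKPq_four]

/-- … and `PhiQ` (with `m = mLast h₀ h₁ h₃ h₄ h₇`) is its `Phi`. -/
theorem PhiQ_four (h0 h1 h2 h3 h4 h5 h6 h7 : ℤ) :
    PhiQ h0 h1 h2 h3 ![h4, h5, h6, h7] h4 (mLast h0 h1 h3 h4 h7) = Phi h0 h1 h2 h3 h4 h5 h6 h7 := by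
  unfold PhiQ Phi
  simp only [nuPq_four]

/-- `ν_{k,p} ≥ 0` for any number of bricks. -/
theorem nuKPq_nonneg (h0 h1 h2 h3 : ℤ) {B : ℕ} (h : Fin B → ℤ) (k : ℤ) {p : ℤ} (hp : 0 < p) :
    0 ≤ nuKPq h0 h1 h2 h3 h k p := by
  unfold nuKPq
  have := pairTerm_nonneg h0 h1 k hp
  have := pairTerm_nonneg h0 h2 k hp
  have := pairTerm_nonneg h0 h3 k hp
  have : 0 ≤ ∑ j, brickTerm h0 (h j) k p := Finset.sum_nonneg fun j _ => brickTerm_nonneg h0 (h j) k hp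
  linarith

/-! ### 2. With `k` at the top tail only alive bricks below `k` save -/

/-- **A brick summand vanishes at a dead prime.** If `h_j ≤ k ≤ h₀ − h_j` and `h₀ − 2h_j < p` then
`[(h₀−2h_j)/p] − [(k−h_j)/p] − [(h₀−h_j−k)/p] = 0` (all three brackets are `0`). -/
theorem brickTerm_eq_zero_of_lt (h0 hj k : ℤ) {p : ℤ} (hjk : hj ≤ k) (hk : k ≤ h0 - hj)
    (hl : h0 - 2 * hj < p) : brickTerm h0 hj k p = 0 := by
  unfold brickTerm
  rw [Int.ediv_eq_zero_of_lt (by linarith) hl, Int.ediv_eq_zero_of_lt (by linarith) (by linarith),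
    Int.ediv_eq_zero_of_lt (by linarith) (by linarith)]
  rfl

/-- Indicator of an ALIVE brick strictly below `k` at `p`: `h_j < k` and `p ≤ h₀ − 2h_j`. -/
def alive (h0 hj k p : ℤ) : ℤ := if hj < k ∧ p ≤ h0 - 2 * hj then 1 else 0

/-- `0 ≤ alive ≤ 1`. -/
theorem alive_nonneg_le_one (h0 hj k p : ℤ) : 0 ≤ alive h0 hj k p ∧ alive h0 hj k p ≤ 1 := by
  unfold alive
  split_ifs <;> simp

/-- Each brick summand is bounded by its alive indicator once `h_j ≤ k` and `2k ≤ h₀`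
(`= 0` for the brick at `k` itself and for dead bricks, `≤ 1` always). -/
theorem brickTerm_le_alive (h0 hj k : ℤ) {p : ℤ} (hp : 0 < p) (hjk : hj ≤ k) (h2k : 2 * k ≤ h0) :
    brickTerm h0 hj k p ≤ alive h0 hj k p := by
  unfold alive
  split_ifs with hc
  · exact brickTerm_le_one h0 hj k hp
  · rw [not_and_or] at hc
    rcases hc with hc | hc
    · obtain rfl : hj = k := le_antisymm hjk (not_lt.1 hc)
      rw [brickTerm_self]
    · exact (brickTerm_eq_zero_of_lt h0 hj k hjk (by linarith) (not_le.1 hc)).le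

/-- **`ν_{k,p} ≤ #{alive bricks below k}` ON THE FACE** (`h₁ = h₂ = h₃ = 1`; any `k` with `h_j ≤ k` for all `j`
and `2k ≤ h₀` — the text's `k = h_q`; any `p > 0`). -/
theorem nuKPq_face_le_alive (h0 : ℤ) {B : ℕ} (h : Fin B → ℤ) (k : ℤ) {p : ℤ} (hp : 0 < p)
    (hk : ∀ j, h j ≤ k) (h2k : 2 * k ≤ h0) :
    nuKPq h0 1 1 1 h k p ≤ ∑ j, alive h0 (h j) k p := by
  unfold nuKPq
  rw [pairTerm_one]
  have := Finset.sum_le_sum (s := Finset.univ) fun j _ => brickTerm_le_alive h0 (h j) k hp (hk j) h2k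
  linarith

/-- **`ν_p ≤ #{alive bricks below k}` ON THE FACE**, whenever `k` lies in the range `kLo ≤ k ≤ h₀ − kLo` of (8.9)
(for `kLo = h₄ ≤ k = h_q < h₀/2` this holds). -/
theorem nuPq_face_le_alive (h0 : ℤ) {B : ℕ} (h : Fin B → ℤ) (kLo k : ℤ) {p : ℤ} (hp : 0 < p)
    (hk : ∀ j, h j ≤ k) (h2k : 2 * k ≤ h0) (hlo : kLo ≤ k) (hhi : k ≤ h0 - kLo) :
    nuPq h0 1 1 1 h kLo p ≤ ∑ j, alive h0 (h j) k p := by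
  have hr : kLo ≤ h0 - kLo := by linarith
  rw [nuPq, dif_pos hr]
  exact (Finset.inf'_le _ (Finset.mem_Icc.2 ⟨hlo, hhi⟩)).trans (nuKPq_face_le_alive h0 h k hp hk h2k)

/-- For a fixed brick `j` below `k`, the primes of `S` at which it is alive all lie in `[0, h₀ − 2h_j]`, so
`∏_{p ∈ S} p^{alive} ≤ (h₀ − 2h_j)#`. -/
theorem prod_pow_alive_le (h0 hj k : ℤ) (S : Finset ℕ) (hS : ∀ p ∈ S, p.Prime) :
    ∏ p ∈ S, p ^ (alive h0 hj k p).toNat ≤ if hj < k then primorial (h0 - 2 * hj).toNat else 1 := by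
  split_ifs with hjk
  · unfold primorial
    have step : ∀ p ∈ S, p ^ (alive h0 hj k p).toNat =
        if p ∈ (Finset.range ((h0 - 2 * hj).toNat + 1)).filter Nat.Prime then p else 1 := by
      intro p hp
      have hp' := hS p hp
      unfold alive
      by_cases hc : (p : ℤ) ≤ h0 - 2 * hj
      · have hmem : p ∈ (Finset.range ((h0 - 2 * hj).toNat + 1)).filter Nat.Prime := by
          refine Finset.mem_filter.2 ⟨Finset.mem_range.2 ?_, hp'⟩
          omega
        simp [hjk, hc, hmem]
      · have hmem : p ∉ (Finset.range ((h0 - 2 * hj).toNat + 1)).filter Nat.Prime := by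
          intro hm
          have := Finset.mem_range.1 (Finset.mem_filter.1 hm).1
          have := hp'.two_le
          omega
        simp [hjk, hc, hmem]
    rw [Finset.prod_congr rfl step, ← Finset.prod_filter]
    apply Finset.prod_le_prod_of_subset_of_one_le'
    · intro p hp
      exact (Finset.mem_filter.1 hp).2
    · intro p hp _
      exact (Finset.mem_filter.1 hp).2.one_lt.le
  · have h0' : ∀ p ∈ S, p ^ (alive h0 hj k p).toNat = 1 := by
      intro p _
      simp [alive, hjk]
    rw [Finset.prod_congr rfl h0', Finset.prod_const_one]

/-- **`Φ ≤ ∏_{j : h_j < k} (h₀ − 2h_j)#` ON THE FACE**: the prime-by-prime saving of Lemma 19 is at most the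
product of the primorials of the pole lengths of the bricks strictly below `k` (`k` as above). -/
theorem PhiQ_face_le (h0 : ℤ) {B : ℕ} (h : Fin B → ℤ) (kLo k m : ℤ) (hk : ∀ j, h j ≤ k)
    (h2k : 2 * k ≤ h0) (hlo : kLo ≤ k) (hhi : k ≤ h0 - kLo) :
    PhiQ h0 1 1 1 h kLo m ≤ ∏ j, if h j < k then primorial (h0 - 2 * h j).toNat else 1 := by
  unfold PhiQ
  set S := (Finset.Ioc (Nat.sqrt h0.toNat) m.toNat).filter Nat.Prime with hSdef
  have hS : ∀ p ∈ S, p.Prime := fun p hp => (Finset.mem_filter.1 hp).2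
  calc ∏ p ∈ S, p ^ (nuPq h0 1 1 1 h kLo p).toNat
      ≤ ∏ p ∈ S, ∏ j, p ^ (alive h0 (h j) k p).toNat := by
        apply Finset.prod_le_prod'
        intro p hp
        have hp' := hS p hp
        rw [Finset.prod_pow_eq_pow_sum]
        apply Nat.pow_le_pow_right hp'.pos
        have h1 := nuPq_face_le_alive h0 h kLo k (p := p) (by exact_mod_cast hp'.pos) hk h2k hlo hhi
        apply Int.toNat_le.2
        refine h1.trans ?_
        push_cast
        exact Finset.sum_le_sum fun j _ => Int.self_le_toNat _
    _ = ∏ j, ∏ p ∈ S, p ^ (alive h0 (h j) k p).toNat := Finset.prod_comm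
    _ ≤ ∏ j, if h j < k then primorial (h0 - 2 * h j).toNat else 1 :=
        Finset.prod_le_prod' fun j _ => prod_pow_alive_le h0 (h j) k S hS

/-! ### 3. Kernel instances at the `q = 9` face MODEL maximiser (`n = 1`: `h = (95; 1,1,1, 23,26,29,32,35,38)`) -/

/-- With the `q = 7` file's choice `k = h₄ = 23`, at the dead prime `p = 53` (`> h₀ − 2h₄ = 49`): `ν_{23,53} = 5`. -/
example : nuKPq 95 1 1 1 ![23, 26, 29, 32, 35, 38] 23 53 = 5 := by
  simp [nuKPq, Fin.sum_univ_succ, pairTerm, brickTerm]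

/-- With `k = h_q = 38` the same prime saves nothing: `ν_{38,53} = 0` … -/
example : nuKPq 95 1 1 1 ![23, 26, 29, 32, 35, 38] 38 53 = 0 := by
  simp [nuKPq, Fin.sum_univ_succ, pairTerm, brickTerm]

/-- … and at `p = 37` exactly the three alive bricks (`h_j = 23, 26, 29`: `95 − 2h_j ≥ 37`) count: `ν_{38,37} = 3`. -/
example : nuKPq 95 1 1 1 ![23, 26, 29, 32, 35, 38] 38 37 = 3 := by
  simp [nuKPq, Fin.sum_univ_succ, pairTerm, brickTerm]

end WellPoisedFace

end Summit.KontsevichZagierPeriods.Zeta5Search
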